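import Literature.Topology.FourManifolds.CorkDecomposition
import Literature.Topology.FourManifolds.CorkDecompositionSplitting
import Literature.Topology.FourManifolds.HalfDiscFromChart
import Literature.Topology.FourManifolds.ConnectedSumSphereIdentity
import Literature.Topology.FourManifolds.BoundaryConnectedSumExistence
import Literature.Topology.FourManifolds.BoundaryConnectedSumProofs
import Literature.Topology.FourManifolds.BoundaryConnectedSumContractible
import HarnessLib

/-!
# The cork decomposition theorem from two named facts (assembly)

Topic `Literature/Topology/FourManifolds`. This file assembles the discharged leaves under the
named fact `Literature.Topology.FourManifolds.corkDecomposition` (`CorkTwist.lean`; Curtis–Freedman–Hsiang–Stong 1996,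
Matveyev 1996) and records the residual dependency:

* `Literature.Topology.FourManifolds.Matveyev1996_decomposition_of_partOne_fact_splitting` and `Literature.Topology.FourManifolds.corkDecomposition_of_facts`:
  `corkDecomposition` (parts 1–2 of Matveyev's Theorem, minus the `H₂` clause) follows from
  1. `Literature.Topology.FourManifolds.Matveyev1996_partOne_and_fact` — part 1 of Matveyev's Theorem together with his "Fact"
     (`W₁ ∪_Σ W₁ ≅ S⁴ ≅ W₁ ∪_Σ W₂` for the pieces constructed in the proof of part 1: the
     5-dimensional h-cobordism / Kirby calculus content of Matveyev 1996 and
     Curtis–Freedman–Hsiang–Stong 1996), `CorkDecomposition.lean`;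
  2. `Literature.Topology.FourManifolds.exists_isConnectedSum_isBoundaryGluing_of_halfDiscs` — Matveyev's fig. 2, the identity
     `(A ∪_Σ B) # (C ∪_Σ' D) ≅ (A ♮ C) ∪_{Σ # Σ'} (B ♮ D)`, `CorkDecompositionSplitting.lean`.

Compared with the tree's `Literature.Topology.FourManifolds.Matveyev1996_decomposition_of_partOne_and_fact` (seven fact
hypotheses), five hypotheses are now theorems: half-discs on small discs need no collar
(`exists_halfDisc_face_eq_of_subset_chartAt`, `HalfDiscFromChart.lean` — the disc
`f : ℝ³ ↪ ∂W₁` of the proof is chosen inside the three relevant boundary charts, by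
`BoundaryData.exists_disc_subset`), `X # Sⁿ ≅ X`
(`nonempty_diffeomorph_of_isConnectedSum_sphere_holds`, `ConnectedSumSphereIdentity.lean`), and
existence, compactness and contractibility of boundary connected sums
(`exists_isOpenGluing_boundaryConnectedSumRel_holds`, `BoundaryConnectedSumExistence.lean`;
`compactSpace_of_isOpenGluing_boundaryConnectedSumRel_holds`, `BoundaryConnectedSumProofs.lean`;
`contractibleSpace_of_isOpenGluing_boundaryConnectedSumRel_holds`,
`BoundaryConnectedSumContractible.lean`). The proof below is that of
`Matveyev1996_decomposition_of_partOne_and_fact` (Matveyev's connected-sum manipulation, proof of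
part 2, fig. 2) with the modified choice of the disc.

## References

* R. Matveyev, *A decomposition of smooth simply-connected h-cobordant 4-manifolds*,
  J. Differential Geom. 44 (1996), 571–582 (arXiv:dg-ga/9505001), Theorem and its proof.
* C. L. Curtis, M. H. Freedman, W. C. Hsiang, R. Stong, *A decomposition theorem for h-cobordant
  smooth simply-connected compact 4-manifolds*, Invent. Math. 123 (1996), 343–348.
* R. Kirby, *Akbulut's corks and h-cobordisms of smooth, simply connected 4-manifolds*, Turkish
  J. Math. 20 (1996), 85–93.
-/

open scoped Manifold ContDiff Topology
open Set Function

noncomputable section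

namespace Literature.Topology.FourManifolds

universe u

/-- Local notation: `𝔼 n` is the model Euclidean space `EuclideanSpace ℝ (Fin n)`. -/
local notation "𝔼 " n:arg => EuclideanSpace ℝ (Fin n)

/-- Local notation for the standard unit sphere `𝕊 n ⊂ ℝⁿ⁺¹`. -/
local notation "𝕊 " n:arg => (Metric.sphere (0 : EuclideanSpace ℝ (Fin (n + 1))) 1)

/-- **Matveyev's Theorem, parts 1–2, from part 1 with the "Fact" and the splitting identity of
fig. 2** — every other ingredient of Matveyev's proof of part 2 being proved in the tree. The
proof repeats that of `Matveyev1996_decomposition_of_partOne_and_fact` with the disc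
`f : ℝ³ ↪ ∂W₁` chosen so small that `f`, `φ₁ ∘ f`, `ψ ∘ f` land in boundary charts of `W₁`,
`M`, `W₂`, where half-discs exist without collars. [cite: Matveyev1996, Theorem, proof of part 2 and fig. 2 (arXiv p. 3)] -/
theorem Matveyev1996_decomposition_of_partOne_fact_splitting
    (hB : Matveyev1996_partOne_and_fact.{u})
    (hS : exists_isConnectedSum_isBoundaryGluing_of_halfDiscs.{u, 0}) :
    Matveyev1996_decomposition.{u} := by
  have hU := nonempty_diffeomorph_of_isConnectedSum_sphere_holds.{u}
  have hE := exists_isOpenGluing_boundaryConnectedSumRel_holds.{u}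
  have hc := compactSpace_of_isOpenGluing_boundaryConnectedSumRel_holds.{u}
  have hk := contractibleSpace_of_isOpenGluing_boundaryConnectedSumRel_holds.{u}
  intro X₁ X₂ _ _ _ _ _ _ _ _ _ _ _ _ _ _ hcob
  obtain ⟨W₁, W₂, M, _, _, _, _, _, _, _, _, _, _, _, _, _, _, _, b₁, b₂, bM, φ₁, φ₂, hc₁, hk₁, hc₂,
    hk₂, hcM, hX₁, hX₂, hSa, hSb⟩ := hB X₁ X₂ hcob
  haveI : CompactSpace W₁ := hc₁
  haveI : CompactSpace W₂ := hc₂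
  haveI : CompactSpace M := hcM
  haveI : ContractibleSpace W₁ := hk₁
  haveI : ContractibleSpace W₂ := hk₂
  -- `∂W₁ ≠ ∅` since the double of `W₁` is the connected `S⁴`
  have hne : Nonempty b₁.carrier := BoundaryData.nonempty_carrier_of_isDouble_sphere hSa
  obtain ⟨z₀⟩ := hne
  set ψ : b₁.carrier ≃ₘ⟮𝓡 3, 𝓡 3⟯ b₂.carrier := φ₁.trans φ₂.symm with hψ
  -- boundary charts of `W₁`, `M`, `W₂` at `z₀`, `φ₁ z₀`, `ψ z₀`
  set p₁ : W₁ := b₁.incl z₀ with hp₁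
  set pM : M := bM.incl (φ₁ z₀) with hpM
  set p₂ : W₂ := b₂.incl (ψ z₀) with hp₂
  set O : Set b₁.carrier := b₁.incl ⁻¹' (chartAt (EuclideanHalfSpace 4) p₁).source ∩
    (φ₁ ⁻¹' (bM.incl ⁻¹' (chartAt (EuclideanHalfSpace 4) pM).source)) ∩
    (ψ ⁻¹' (b₂.incl ⁻¹' (chartAt (EuclideanHalfSpace 4) p₂).source)) with hO
  have hOn : O ∈ 𝓝 z₀ := by
    refine ((IsOpen.inter (IsOpen.inter ?_ ?_) ?_).mem_nhds ⟨⟨?_, ?_⟩, ?_⟩)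
    · exact (chartAt _ p₁).open_source.preimage b₁.continuous_incl
    · exact ((chartAt _ pM).open_source.preimage bM.continuous_incl).preimage φ₁.continuous
    · exact ((chartAt _ p₂).open_source.preimage b₂.continuous_incl).preimage ψ.continuous
    · exact mem_chart_source _ p₁
    · exact mem_chart_source _ pM
    · exact mem_chart_source _ p₂
  -- a small disc `f : ℝ³ ↪ ∂W₁` through `z₀` inside the three chart domains
  obtain ⟨f, hf, hfo, hfO, -⟩ := b₁.exists_disc_subset z₀ hOn
  have hfφ : Manifold.IsSmoothEmbedding (𝓡 3) (𝓡 3) ∞ (φ₁ ∘ f) := hf.diffeomorph_comp φ₁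
  have hfφo : IsOpen (range (φ₁ ∘ f)) := by
    rw [range_comp]; exact φ₁.toHomeomorph.isOpenMap _ hfo
  have hfψ : Manifold.IsSmoothEmbedding (𝓡 3) (𝓡 3) ∞ (ψ ∘ f) := hf.diffeomorph_comp ψ
  have hfψo : IsOpen (range (ψ ∘ f)) := by
    rw [range_comp]; exact ψ.toHomeomorph.isOpenMap _ hfo
  -- half-discs `k₁ ⊂ W₁`, `k_M ⊂ M`, `k₂ ⊂ W₂` with faces `f`, `φ₁ ∘ f`, `ψ ∘ f` (no collar)
  obtain ⟨k₁, e₁, o₁, hface₁⟩ := exists_halfDisc_face_eq_of_subset_chartAt b₁ hf hfo p₁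
    fun x' => (hfO (mem_range_self x')).1.1
  obtain ⟨kM, eM, oM, hfaceM⟩ := exists_halfDisc_face_eq_of_subset_chartAt bM hfφ hfφo pM
    fun x' => (hfO (mem_range_self x')).1.2
  obtain ⟨k₂, e₂, o₂, hface₂⟩ := exists_halfDisc_face_eq_of_subset_chartAt b₂ hfψ hfψo p₂
    fun x' => (hfO (mem_range_self x')).2
  -- the new cork `W' = W₁ ♮ W₂` and the new exterior `M' = M ♮ W₁`
  obtain ⟨W', _, _, _, _, _, hW'⟩ := hE _ W₁ W₂ k₁ k₂ e₁ o₁ e₂ o₂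
  obtain ⟨M', _, _, _, _, _, hM'⟩ := hE _ M W₁ kM k₁ eM oM e₁ o₁
  haveI : CompactSpace W' := hc _ W₁ W₂ W' k₁ k₂ e₁ o₁ e₂ o₂ hW'
  haveI : CompactSpace M' := hc _ M W₁ M' kM k₁ eM oM e₁ o₁ hM'
  have hkW' : ContractibleSpace W' := hk _ W₁ W₂ W' k₁ k₂ hk₁ hk₂ e₁ o₁ e₂ o₂ hW'
  have hW'symm : IsOpenGluing (𝓡∂ 4) (𝓡∂ 4) (𝓡∂ 4) (A := puncture k₂) (B := puncture k₁)
      (P := W') (boundaryConnectedSumRel k₂ k₁) := by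
    rw [← boundaryConnectedSumRel_swap]
    exact hW'.symm
  -- chain 1: `X₁ # S⁴ = (W₁ ∪_{φ₁} M) # (W₂ ∪_{ψ⁻¹} W₁) = W' ∪ M'`
  have hSb' : IsBoundaryGluing b₂ b₁ ψ.symm (𝓡 4) (𝕊 4) := hSb.symm'
  have hfaceD₁ : ∀ x', k₁ (EuclideanHalfSpace.face x') = b₁.incl (ψ.symm ((ψ ∘ f) x')) :=
    fun x' => by rw [hface₁]; simp
  obtain ⟨Q₁, _, _, _, _, _, β₁, β₁', θ₁, hcs₁, hg₁⟩ :=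
    hS 2 W₁ M W₂ W₁ W' M' X₁ (𝕊 4) b₁ bM b₂ b₁ φ₁ ψ.symm k₁ kM k₂ k₁ f (ψ ∘ f) hX₁ hSb'
      e₁ o₁ eM oM e₂ o₂ e₁ o₁ hface₁ hfaceM hface₂ hfaceD₁ hW' hM'
  obtain ⟨eQ₁⟩ := hU _ X₁ Q₁ hcs₁
  have hg₁X : IsBoundaryGluing β₁ β₁' θ₁ (𝓡 4) X₁ := hg₁.diffeomorph_comp eQ₁
  -- chain 2: `X₂ # S⁴ = (W₂ ∪_{φ₂} M) # (W₁ ∪_{id} W₁) = W' ∪ M'` (`W' = W₂ ♮ W₁` by symmetry)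
  have hSa' : IsBoundaryGluing b₁ b₁ (Diffeomorph.refl (𝓡 3) b₁.carrier ∞) (𝓡 4) (𝕊 4) :=
    isBoundaryGluing_congr (fun z => by simp) hSa.isBoundaryGluing
  have hfaceM₂ : ∀ x', kM (EuclideanHalfSpace.face x') = bM.incl (φ₂ ((ψ ∘ f) x')) :=
    fun x' => by rw [hfaceM]; simp [hψ]
  have hfaceD₂ : ∀ x', k₁ (EuclideanHalfSpace.face x') =
      b₁.incl ((Diffeomorph.refl (𝓡 3) b₁.carrier ∞) (f x')) :=
    fun x' => by rw [hface₁]; simp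
  obtain ⟨Q₂, _, _, _, _, _, β₂, β₂', θ₂, hcs₂, hg₂⟩ :=
    hS 2 W₂ M W₁ W₁ W' M' X₂ (𝕊 4) b₂ bM b₁ b₁ φ₂ (Diffeomorph.refl (𝓡 3) b₁.carrier ∞)
      k₂ kM k₁ k₁ (ψ ∘ f) f hX₂ hSa' e₂ o₂ eM oM e₁ o₁ e₁ o₁ hface₂ hfaceM₂ hface₁ hfaceD₂
      hW'symm hM'
  obtain ⟨eQ₂⟩ := hU _ X₂ Q₂ hcs₂
  have hg₂X : IsBoundaryGluing β₂ β₂' θ₂ (𝓡 4) X₂ := hg₂.diffeomorph_comp eQ₂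
  -- re-index the second gluing to the boundary data `β₁`, `β₁'` of the first
  have h₁ : IsBoundaryGluing β₁ β₂'
      ((β₁.restrictDiffeomorph β₂ (Diffeomorph.refl (𝓡∂ 4) W' ∞)).trans θ₂) (𝓡 4) X₂ :=
    IsClosedGluing.congr (hg₂X.transfer (b₁ := β₁) (Diffeomorph.refl (𝓡∂ 4) W' ∞))
      fun a b => Iff.rfl
  have h₂ : IsBoundaryGluing β₁' β₁ ((β₁'.restrictDiffeomorph β₂'
      (Diffeomorph.refl (𝓡∂ 4) M' ∞)).trans
        ((β₁.restrictDiffeomorph β₂ (Diffeomorph.refl (𝓡∂ 4) W' ∞)).trans θ₂).symm) (𝓡 4) X₂ :=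
    IsClosedGluing.congr (h₁.symm'.transfer (b₁ := β₁') (Diffeomorph.refl (𝓡∂ 4) M' ∞))
      fun a b => Iff.rfl
  exact ⟨W', W', M', ‹_›, ‹_›, ‹_›, ‹_›, ‹_›, ‹_›, ‹_›, ‹_›, ‹_›, ‹_›, ‹_›, ‹_›, ‹_›, ‹_›, ‹_›,
    β₁, β₁, β₁', θ₁, _, ‹_›, hkW', ‹_›, hkW', ‹_›, hg₁X, h₂.symm', ⟨Diffeomorph.refl (𝓡∂ 4) W' ∞⟩⟩

/-- **The cork decomposition theorem** `Literature.Topology.FourManifolds.corkDecomposition` (`CorkTwist.lean`) **from the two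
named facts**: Matveyev's part 1 with the Fact, and the splitting identity of fig. 2.
[cite: Matveyev1996, Theorem] -/
theorem corkDecomposition_of_facts (hB : Matveyev1996_partOne_and_fact.{u})
    (hS : exists_isConnectedSum_isBoundaryGluing_of_halfDiscs.{u, 0}) : corkDecomposition.{u} :=
  corkDecomposition_of_matveyev1996 (Matveyev1996_decomposition_of_partOne_fact_splitting hB hS)

end Literature.Topology.FourManifolds
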